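/-
Copyright (c) 2026 the pub-hodgecm-mathlib formalisation cell (harness21).  Prover seat hodgecm-mathlib-A-p12 (g24), 2026-09-02.  «S3-ram» seeding wave (LEAD F0P3a-plan (g12∕g13);
owner F0P3a-p06 (g15)): organ (B-i) «DEPTH-REFINED FIXED BALLS» of the (α₂) TYPE-(2) line, IV — the TOP `j = n` at even depth: NO γ_W-fixed self-dual lattice of the hyperbolic
plane has `(γ_W − ½tr)·B ⊆ ϖ_v^n B` («m⁰(0) = 0»).  Kernel lane, `--supports stmt-HodgeConjecture-24833`.
-/
import Literature.NumberTheory.Rogawski1990.DepthZeroKappaTransferTypeTwoRamifiedRescaling   -- ★ p847537 (this seat) I: `trace_and_det_of_descent`, ★ FILE C∕B∕A, the (W1) descent, ★ p847118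
import Literature.NumberTheory.Automorphic.RamifiedPlaceEisensteinBasis                       -- ★ `exists_eq_toPlace_add_toPlace_mul`, `valued_toPlace_add_toPlace_mul` (the basis `(1, ϖ)`)
import Literature.NumberTheory.Automorphic.Liu2021.LemD1AsPrintedIndexedNonVacuityRamifiedConverse   -- ★ `valued_galAdicCompletionMap_sub_lt_one_of_ramified` (σ_w is residually trivial)
import HarnessLib

/-!
# Depth-refined fixed balls of a type-(2) element at a tame-ramified place, IV — THE TOP: at even discriminant depth `2·2n` the `K⁰`-column at `j = n` is EMPTY,
# `#{hK⁰ : (γ_W − ½tr)·(h𝒪_w²) ⊆ ϖ_v^n·(h𝒪_w²)} = 0 = (q+1)·Σ_(k<0) q^k` (Labesse–Langlands 1979 §2; Kottwitz 1988 §2; Rogawski 1990 §4.9)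

Topic `NumberTheory/Rogawski1990`; namespace `Literature.NumberTheory.Automorphic.UnitaryGroup`.  THEOREMS ONLY (no definition, no instance, no notation, no named fact,
no `sorry`); kernel lane `--supports stmt-HodgeConjecture-24833`.  Cell `pub/hodgecm-mathlib` (D-0151), crux H413; «S3-ram» seeding wave (count-neutral); seat A-p12 (g24).
Files II∕III (★ p847555∕p847556) give the inner balls `m⁰(N − 2j)` for `j < n`; the (S-0) anatomy of F0P3a-p07 (g13)'s ledger v1.3 also uses the boundary `m⁰(0) = 0`
(`N = 4`, hair (3,1): no axis vertex of depth `≥ 5`), i.e. the case `j = n`, which the rescaling of file I does not reach (`det g_n` need not be a square).  HONEST LABEL: HC_CM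
is proved only modulo the cell's 2 remaining named inputs (hLiu418 24832, h413 24833) until rung 0 closes; nothing printed is asserted here — a residual `2 × 2` computation.

THE MATHEMATICS (why the hyperbolic axis has no top).  Let `γ₂ ∈ U₂` be of type (2) with `|tr² − 4det|_w(γ_{2,w}) = exp(−2·2n)`, `n ≥ 1`, `c := ½tr γ_{2,w}`, and suppose
`M := E₂(h⁻¹γ₂h)` satisfies `|(M − c·1)_{ab}|_w ≤ |ϖ|^{2n}`.  Then `Q := ϖ^{−2n}(M − c·1)` is INTEGRAL with `Q² = ϖ^{−4n}(c² − det M)·1 = w₀²·ι(ε₀)·1` (Cayley–Hamilton for the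
traceless `M − c·1`; `c² − det M = s²ι(¼(t² − 4d)) = (½sιz)²·ι(ε₀)` from the (W1) descent `(s, g)` and ★ p847118's even branch `t² − 4d = ε₀z²`, `|z∕t| = |ϖ_F|ⁿ`; `w₀ = ½sιz∕ϖ^{2n}` is a
UNIT because `|sιt| = |2|`).  On the other hand `M = c·1 + ϖ^{2n}Q` is UNITARY for `J = antidiag(1,1)`: the `(0,0)` and `(1,1)` entries of `ᵗσ(M)·J·M = J` read
`σ(c)Q₁₀ + c·σ(Q₁₀) ≡ 0` and `σ(c)Q₀₁ + c·σ(Q₀₁) ≡ 0 (mod ϖ^{2n})`, and `σ_w` is RESIDUALLY TRIVIAL at a ramified place (★ Liu2021 converse lemma), so `|2cQ₁₀|, |2cQ₀₁| < 1`,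
i.e. `Q` is residually DIAGONAL (`|2| = |c| = 1`).  Hence `Q₀₀² = w₀²ιε₀ − Q₀₁Q₁₀ ≡ w₀²ιε₀`, so `b := Q₀₀∕w₀ ∈ 𝒪_w` has `|b² − ιε₀| < 1` — impossible: `ε₀` is a non-square UNIT of
`L⁺_v` and `𝒪_w = 𝒪_v ⊕ 𝒪_vϖ` (★ Eisenstein basis), so `|b² − ιε₀|_w = |p² − ε₀|_v² = 1` for `b = ιp + ιqϖ`.  (For the ANISOTROPIC plane the residual form is `diag(1, −ε₀)` and the
same computation produces the single `𝒪_{L_w(√ε₀)}`-stable self-dual root of the t₁ literal — the dichotomy behind (L1).)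

* §1 `sq_sub_half_trace_smul_one` (Cayley–Hamilton, traceless part), `valued_sq_sub_toPlace_eq_one_of_nonsquare` (`|b² − ιε₀|_w = 1` on `𝒪_w`), `valued_two_mul_lt_one_of_unitary_entry`
  (the two unitarity congruences).
* §2 **`depthFixed_selfDual_top_eq_empty_of_even_depth_ramified`** — the set is `∅`, and **`natCard_depthFixed_selfDual_top_of_even_depth_ramified`** — its `Nat.card` is
  `(q+1)·Σ_(k ∈ range (n−n)) q^k` (the `j = n` instance of file II's formula, so consumers quantify `j ≤ n` uniformly).

## References
* [LabesseLanglands1979] J.-P. Labesse, R. P. Langlands, *L-indistinguishability for SL(2)*, Canad. J. Math. 31 (1979): §2 Lemma 2.1 p. 8.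
* [Kottwitz1988] R. E. Kottwitz, *Tamagawa numbers*, Ann. of Math. 127 (1988): §2.
* [Rogawski1990] J. D. Rogawski, *Automorphic Representations of Unitary Groups in Three Variables*, Ann. of Math. Stud. 123 (1990): §4.9 Lemma 4.9.3 p. 56; §3.6 p. 31.
* [Serre1979] J.-P. Serre, *Local Fields*, GTM 67 (1979): Ch. I §6 Prop. 18; Ch. II §2.
-/

set_option autoImplicit false

noncomputable section

open MeasureTheory Measure Set NumberField IsDedekindDomain Matrix ValuativeRel MulAction Finset
open scoped ValuativeRel Matrix MatrixGroups WithZero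

namespace Literature.NumberTheory.Automorphic.UnitaryGroup

open Literature.NumberTheory.Rogawski1990 Literature.NumberTheory.Automorphic Literature.NumberTheory.Automorphic.IntegralReduction
open Literature.NumberTheory.Automorphic.HermitianLatticeTree Literature.GroupTheory Literature.NumberTheory.GaloisRepresentations

/-! ## §1 Three lemmas -/

section Lemmas

/-- **CAYLEY–HAMILTON FOR THE TRACELESS PART**: `(M − ½tr M·1)² = (¼tr²M − det M)·1` for a `2 × 2` matrix (`2 ≠ 0`). [cite: Rogawski1990, §3.6 p. 31] -/
theorem sq_sub_half_trace_smul_one {K : Type*} [Field K] (h2 : (2 : K) ≠ 0) (M : Matrix (Fin 2) (Fin 2) K) :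
    (M - (M.trace / 2) • (1 : Matrix (Fin 2) (Fin 2) K)) * (M - (M.trace / 2) • (1 : Matrix (Fin 2) (Fin 2) K)) = ((M.trace / 2) ^ 2 - M.det) • (1 : Matrix (Fin 2) (Fin 2) K) := by
  rw [Matrix.trace_fin_two, Matrix.det_fin_two]
  ext i j
  fin_cases i <;> fin_cases j <;> simp [Matrix.mul_apply, Fin.sum_univ_two, Matrix.one_apply] <;> field_simp <;> ring

variable (L : Type) [Field L] [NumberField L] [IsCMField L] (v : HeightOneSpectrum (𝓞 ↥(maximalRealSubfield L)))
  (w : PlacesOver L v) (hw : IsCMField.complexConj L • w.1 = w.1)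

include hw in
/-- **A NON-SQUARE UNIT OF `L⁺_v` STAYS A RESIDUAL NON-SQUARE IN `L_w` (ramified ⇒ same residue field)**: if `|p² − ε₀|_v = 1` for every `p ∈ 𝒪_v`, then `|b² − ι ε₀|_w = 1` for every
`b ∈ 𝒪_w` — write `b = ιp + ιq·ϖ` (★ `exists_eq_toPlace_add_toPlace_mul`), so `b² − ιε₀ = ι(p² − ε₀) + ϖ·(…)`. [cite: Serre1979, Ch. I §6 Prop. 18; Ch. II §2] -/
theorem valued_sq_sub_toPlace_eq_one_of_nonsquare (he : v.asIdeal.ramificationIdx' w.1.asIdeal ≠ 1)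
    {ϖ : (w.1.adicCompletion L)} (hϖ : Valued.v ϖ = WithZero.exp (-1 : ℤ))
    {ε₀ : (v.adicCompletion ↥(maximalRealSubfield L))} (hns : ∀ p : (v.adicCompletion ↥(maximalRealSubfield L)), p ∈ 𝒪[(v.adicCompletion ↥(maximalRealSubfield L))] → valuation (v.adicCompletion ↥(maximalRealSubfield L)) (p ^ 2 - ε₀) = 1)
    (b : (w.1.adicCompletion L)) (hb : Valued.v b ≤ 1) : Valued.v (b ^ 2 - toPlace v w ε₀) = 1 := by
  obtain ⟨p, q, rfl⟩ := exists_eq_toPlace_add_toPlace_mul L v w hw he hϖ b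
  have hpq := hb
  rw [valued_toPlace_add_toPlace_mul L v w hw he hϖ, max_le_iff, sq_le_one_iff_withZero, sq_mul_exp_neg_one_le_one_iff] at hpq
  obtain ⟨hp, hq⟩ := hpq
  have hp1 : Valued.v (toPlace v w (p ^ 2 - ε₀)) = 1 := by
    rw [valued_toPlace_eq_sq_of_ramified L v w hw he, (v_eq_one_iff_valuation_eq_one _).2 (hns p ((v_le_one_iff_mem_integer p).1 hp)), one_pow]
  have e : (toPlace v w p + toPlace v w q * ϖ) ^ 2 - toPlace v w ε₀ = toPlace v w (p ^ 2 - ε₀) + ϖ * (toPlace v w q * (2 * toPlace v w p + toPlace v w q * ϖ)) := by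
    rw [map_sub, map_pow]; ring
  have hsmall : Valued.v (ϖ * (toPlace v w q * (2 * toPlace v w p + toPlace v w q * ϖ))) < 1 := by
    have hιp : Valued.v (toPlace v w p) ≤ 1 := by rw [valued_toPlace_eq_sq_of_ramified L v w hw he]; exact pow_le_one₀ zero_le hp
    have hιq : Valued.v (toPlace v w q) ≤ 1 := by rw [valued_toPlace_eq_sq_of_ramified L v w hw he]; exact pow_le_one₀ zero_le hq
    have hϖ1 : Valued.v ϖ < 1 := by rw [hϖ, ← WithZero.exp_zero, WithZero.exp_lt_exp]; norm_num
    have h2 : Valued.v (2 : (w.1.adicCompletion L)) ≤ 1 := by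
      have h := v_natCast_le_one (K := (w.1.adicCompletion L)) 2
      rwa [Nat.cast_ofNat] at h
    have hin : Valued.v (toPlace v w q * (2 * toPlace v w p + toPlace v w q * ϖ)) ≤ 1 := by
      rw [Valuation.map_mul]
      refine mul_le_one' hιq ((Valuation.map_add _ _ _).trans (max_le ?_ ?_))
      · rw [Valuation.map_mul]; exact mul_le_one' h2 hιp
      · rw [Valuation.map_mul]; exact mul_le_one' hιq hϖ1.le
    rw [Valuation.map_mul]
    exact mul_lt_one_of_lt_of_le hϖ1 hin
  rw [e, Valuation.map_add_eq_of_lt_left]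
  · exact hp1
  · rw [hp1]; exact hsmall

include hw in
/-- **THE UNITARITY CONGRUENCE AT A DIAGONAL ENTRY.**  If `M = c·1 + π·Q` with `Q` integral, `|c| ≤ 1`, `σ_w π = π ≠ 0`, and `ᵗσ(M)·J·M = J` for `J = antidiag(1,1)`, then
`|2·c·Q₁₀|_w < 1` and `|2·c·Q₀₁|_w < 1`: the `(0,0)`∕`(1,1)` entries of the unitarity relation give `σ(c)Q₁₀ + cσ(Q₁₀) = −π·(…)`, and `σ_w` is residually trivial at a ramified
place (★ `valued_galAdicCompletionMap_sub_lt_one_of_ramified`). [cite: Rogawski1990, §4.9 p. 55] [cite: Serre1979, Ch. II §2] -/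
theorem valued_two_mul_lt_one_of_unitary_entry (he : v.asIdeal.ramificationIdx' w.1.asIdeal ≠ 1)
    {M Q : Matrix (Fin 2) (Fin 2) (w.1.adicCompletion L)} {c π : (w.1.adicCompletion L)} (hM : M = c • (1 : Matrix (Fin 2) (Fin 2) (w.1.adicCompletion L)) + π • Q)
    (hQ : ∀ a b : Fin 2, Valued.v (Q a b) ≤ 1) (hc : Valued.v c ≤ 1) (hπ0 : π ≠ 0) (hπ1 : Valued.v π < 1)
    (hσπ : galAdicCompletionMap (L := L) (IsCMField.complexConj L) hw π = π)
    (hU : (M.map (galAdicCompletionMap (L := L) (IsCMField.complexConj L) hw))ᵀ * !![(0 : (w.1.adicCompletion L)), 1; 1, 0] * M = !![(0 : (w.1.adicCompletion L)), 1; 1, 0]) :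
    Valued.v (2 * c * Q 1 0) < 1 ∧ Valued.v (2 * c * Q 0 1) < 1 := by
  have hc1 : IsCMField.complexConj L ≠ 1 := IsCMField.complexConj_ne_one L
  set σ := galAdicCompletionMap (L := L) (IsCMField.complexConj L) hw with hσdef
  have hσv : ∀ x : (w.1.adicCompletion L), Valued.v (σ x) = Valued.v x := fun x => by
    rw [hσdef, valued_galAdicCompletionMap]
  have hres : ∀ x : (w.1.adicCompletion L), Valued.v x ≤ 1 → Valued.v (σ x - x) < 1 := fun x hx =>
    Liu2021.LemD1IndexedNonVacuityRamifiedConverse.valued_galAdicCompletionMap_sub_lt_one_of_ramified L (IsCMField.complexConj L) v hc1 w hw he x hx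
  -- the two diagonal entries of the unitarity relation
  have hent : ∀ a b : Fin 2, ((M.map σ)ᵀ * !![(0 : (w.1.adicCompletion L)), 1; 1, 0] * M) a b = σ (M 0 a) * M 1 b + σ (M 1 a) * M 0 b := by
    intro a b
    simp [Matrix.mul_apply, Fin.sum_univ_two, Matrix.transpose_apply, Matrix.map_apply]
    ring
  have h00 : σ (M 0 0) * M 1 0 + σ (M 1 0) * M 0 0 = 0 := by
    have h := congrArg (fun X : Matrix (Fin 2) (Fin 2) (w.1.adicCompletion L) => X 0 0) hU
    simpa [hent] using h
  have h11 : σ (M 0 1) * M 1 1 + σ (M 1 1) * M 0 1 = 0 := by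
    have h := congrArg (fun X : Matrix (Fin 2) (Fin 2) (w.1.adicCompletion L) => X 1 1) hU
    simpa [hent] using h
  have hM00 : M 0 0 = c + π * Q 0 0 := by rw [hM]; simp
  have hM11 : M 1 1 = c + π * Q 1 1 := by rw [hM]; simp
  have hM01 : M 0 1 = π * Q 0 1 := by rw [hM]; simp
  have hM10 : M 1 0 = π * Q 1 0 := by rw [hM]; simp
  rw [hM00, hM10, map_add, map_mul, map_mul, hσπ] at h00
  rw [hM01, hM11, map_add, map_mul, map_mul, hσπ] at h11
  have key10 : σ c * Q 1 0 + c * σ (Q 1 0) = -(π * (σ (Q 0 0) * Q 1 0 + σ (Q 1 0) * Q 0 0)) := by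
    have h' : π * (σ c * Q 1 0 + c * σ (Q 1 0) + π * (σ (Q 0 0) * Q 1 0 + σ (Q 1 0) * Q 0 0)) = 0 := by
      linear_combination h00
    have h'' := (mul_eq_zero.1 h').resolve_left hπ0
    linear_combination h''
  have key01 : σ c * Q 0 1 + c * σ (Q 0 1) = -(π * (σ (Q 0 1) * Q 1 1 + σ (Q 1 1) * Q 0 1)) := by
    have h' : π * (σ c * Q 0 1 + c * σ (Q 0 1) + π * (σ (Q 0 1) * Q 1 1 + σ (Q 1 1) * Q 0 1)) = 0 := by
      linear_combination h11
    have h'' := (mul_eq_zero.1 h').resolve_left hπ0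
    linear_combination h''
  have hbound : ∀ x y : (w.1.adicCompletion L), Valued.v x ≤ 1 → Valued.v y ≤ 1 → Valued.v (-(π * (σ x * y + σ y * x))) < 1 := by
    intro x y hx hy
    rw [Valuation.map_neg, Valuation.map_mul]
    refine mul_lt_one_of_lt_of_le hπ1 ((Valuation.map_add _ _ _).trans (max_le ?_ ?_))
    · rw [Valuation.map_mul, hσv]; exact mul_le_one' hx hy
    · rw [Valuation.map_mul, hσv]; exact mul_le_one' hy hx
  have hsplit : ∀ x : (w.1.adicCompletion L), Valued.v x ≤ 1 → Valued.v (σ c * x + c * σ x) < 1 → Valued.v (2 * c * x) < 1 := by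
    intro x hx hlt
    have e : 2 * c * x = (σ c * x + c * σ x) - (σ c - c) * x - c * (σ x - x) := by ring
    rw [e]
    refine Valuation.map_sub_lt _ (Valuation.map_sub_lt _ hlt ?_) ?_
    · rw [Valuation.map_mul]; exact mul_lt_one_of_lt_of_le (hres c hc) hx
    · rw [Valuation.map_mul, mul_comm]; exact mul_lt_one_of_lt_of_le (hres x hx) hc
  refine ⟨hsplit _ (hQ 1 0) ?_, hsplit _ (hQ 0 1) ?_⟩
  · rw [key10]; exact hbound _ _ (hQ 0 0) (hQ 1 0)
  · rw [key01]; exact hbound _ _ (hQ 0 1) (hQ 1 1)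

end Lemmas

/-! ## §2 The top of the hyperbolic axis is empty -/

section Top

variable (L : Type) [Field L] [NumberField L] [IsCMField L] (v : HeightOneSpectrum (𝓞 ↥(maximalRealSubfield L)))
  (w : PlacesOver L v) (hw : IsCMField.complexConj L • w.1 = w.1)

set_option maxHeartbeats 1600000 in
include hw in
/-- **THE TOP IS EMPTY (even depth `2n`, `j = n`).**  For a type-(2) `γ₂ ∈ U₂` with `|tr² − 4det|_w(γ_{2,w}) = exp(−2·2n)`, `1 ≤ n`, at a tame-ramified place, NO coset `hK⁰` has
`|(E₂(h⁻¹γ₂h) − ½tr·1)_{ab}|_w ≤ |ϖ^(2n)|_w` for all `a b` — no `γ_W`-fixed self-dual lattice `B` of the hyperbolic plane has `(γ_W − ½tr γ_W)·B ⊆ ϖ_v^n·B` («`m⁰(0) = 0`»).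
See the module docstring for the residual argument. [cite: LabesseLanglands1979, §2 Lemma 2.1 p. 8] [cite: Rogawski1990, §4.9 Lemma 4.9.3 p. 56] -/
theorem depthFixed_selfDual_top_eq_empty_of_even_depth_ramified (he : v.asIdeal.ramificationIdx' w.1.asIdeal ≠ 1) (h2 : IsUnit (2 : 𝒪[(w.1.adicCompletion L)]))
    (ϖ : (w.1.adicCompletion L)ˣ) (hϖ : Valued.v (ϖ : (w.1.adicCompletion L)) = WithZero.exp (-1 : ℤ))
    (hσϖ : galAdicCompletionMap (L := L) (IsCMField.complexConj L) hw (ϖ : (w.1.adicCompletion L)) = -(ϖ : (w.1.adicCompletion L)))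
    (γ₂ : ((cmDatum L 2 (Matrix.of fun i j : Fin 2 => if i.val + j.val + 1 = 2 then (1 : L) else 0)).Local v))
    (hirr : ¬ ∃ x : (w.1.adicCompletion L), (((((localNonsplitEquiv (IsCMField.complexConj L) (Matrix.of fun i j : Fin 2 => if i.val + j.val + 1 = 2 then (1 : L) else 0) (IsCMField.complexConj_ne_one L) w hw) γ₂ : ↥(unitaryGroupOfForm (galAdicCompletionMap (L := L) (IsCMField.complexConj L) hw) (placeForm (Matrix.of fun i j : Fin 2 => if i.val + j.val + 1 = 2 then (1 : L) else 0) w.1))) : GL (Fin 2) (w.1.adicCompletion L)) : Matrix (Fin 2) (Fin 2) (w.1.adicCompletion L)).charpoly).IsRoot x)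
    {n : ℕ} (hn1 : 1 ≤ n) (hN : Valued.v (((((localNonsplitEquiv (IsCMField.complexConj L) (Matrix.of fun i j : Fin 2 => if i.val + j.val + 1 = 2 then (1 : L) else 0) (IsCMField.complexConj_ne_one L) w hw) γ₂ : ↥(unitaryGroupOfForm (galAdicCompletionMap (L := L) (IsCMField.complexConj L) hw) (placeForm (Matrix.of fun i j : Fin 2 => if i.val + j.val + 1 = 2 then (1 : L) else 0) w.1))) : GL (Fin 2) (w.1.adicCompletion L)) : Matrix (Fin 2) (Fin 2) (w.1.adicCompletion L)).trace ^ 2 - 4 * ((((localNonsplitEquiv (IsCMField.complexConj L) (Matrix.of fun i j : Fin 2 => if i.val + j.val + 1 = 2 then (1 : L) else 0) (IsCMField.complexConj_ne_one L) w hw) γ₂ : ↥(unitaryGroupOfForm (galAdicCompletionMap (L := L) (IsCMField.complexConj L) hw) (placeForm (Matrix.of fun i j : Fin 2 => if i.val + j.val + 1 = 2 then (1 : L) else 0) w.1))) : GL (Fin 2) (w.1.adicCompletion L)) : Matrix (Fin 2) (Fin 2) (w.1.adicCompletion L)).det) = WithZero.exp (-((2 * (2 * n) : ℕ) : ℤ)))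 :
    {x : ((cmDatum L 2 (Matrix.of fun i j : Fin 2 => if i.val + j.val + 1 = 2 then (1 : L) else 0)).Local v) ⧸ (cmLocalIntegralLevel L 2 (Matrix.of fun i j : Fin 2 => if i.val + j.val + 1 = 2 then (1 : L) else 0) v) | ∃ h : ((cmDatum L 2 (Matrix.of fun i j : Fin 2 => if i.val + j.val + 1 = 2 then (1 : L) else 0)).Local v), x = (h : ((cmDatum L 2 (Matrix.of fun i j : Fin 2 => if i.val + j.val + 1 = 2 then (1 : L) else 0)).Local v) ⧸ (cmLocalIntegralLevel L 2 (Matrix.of fun i j : Fin 2 => if i.val + j.val + 1 = 2 then (1 : L) else 0) v)) ∧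
      ∀ a b : Fin 2, Valued.v ((((((localNonsplitEquiv (IsCMField.complexConj L) (Matrix.of fun i j : Fin 2 => if i.val + j.val + 1 = 2 then (1 : L) else 0) (IsCMField.complexConj_ne_one L) w hw) (h⁻¹ * γ₂ * h) : ↥(unitaryGroupOfForm (galAdicCompletionMap (L := L) (IsCMField.complexConj L) hw) (placeForm (Matrix.of fun i j : Fin 2 => if i.val + j.val + 1 = 2 then (1 : L) else 0) w.1))) : GL (Fin 2) (w.1.adicCompletion L)) : Matrix (Fin 2) (Fin 2) (w.1.adicCompletion L)) - (((((localNonsplitEquiv (IsCMField.complexConj L) (Matrix.of fun i j : Fin 2 => if i.val + j.val + 1 = 2 then (1 : L) else 0) (IsCMField.complexConj_ne_one L) w hw) γ₂ : ↥(unitaryGroupOfForm (galAdicCompletionMap (L := L) (IsCMField.complexConj L) hw) (placeForm (Matrix.of fun i j : Fin 2 => if i.val + j.val + 1 = 2 then (1 : L) else 0) w.1))) : GL (Fin 2) (w.1.adicCompletion L)) : Matrix (Fin 2) (Fin 2) (w.1.adicCompletion L)).trace / 2) • (1 : Matrix (Fin 2) (Fin 2) (w.1.adicCompletion L))) a b)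 ≤ Valued.v ((ϖ : (w.1.adicCompletion L)) ^ (2 * n))} = ∅ := by
  have hc1 : IsCMField.complexConj L ≠ 1 := IsCMField.complexConj_ne_one L
  have hϖ0 : (ϖ : (w.1.adicCompletion L)) ≠ 0 := ϖ.ne_zero
  obtain ⟨h2v, h2v0⟩ := valued_two_eq_one_of_isUnit_two_of_ramified L v w hw he h2
  obtain ⟨h2w, h2w0⟩ := valued_two_eq_one_of_ramified L v w hw he h2v
  -- descent, non-square unit, parity (★ p847118, even branch)
  have hu := coe_mem_unitaryGroupOfForm_antidiag_two_of_mem_placeForm L w hw ((localNonsplitEquiv (IsCMField.complexConj L) (Matrix.of fun i j : Fin 2 => if i.val + j.val + 1 = 2 then (1 : L) else 0) (IsCMField.complexConj_ne_one L) w hw) γ₂)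
  obtain ⟨s, g, hs, hsg⟩ := descent_of_mem_unitaryGroupOfForm_antidiag L v w hw hσϖ hϖ0 _ hu
  obtain ⟨ε₀, hε₀, hns⟩ := exists_forall_valuation_sq_sub_eq_one L v h2v
  have hϖF := HeckeCharacter.valued_uniformizer (K := ↥(maximalRealSubfield L)) v
  obtain ⟨ht, z, hz, hD, hzn⟩ := descent_trace_ne_zero_and_exists_eq_nonsquare_mul_sq_of_even_of_ramified L v w hw he h2v hu hirr hn1 hN hϖ0
    (g := (g : Matrix (Fin 2) (Fin 2) (v.adicCompletion ↥(maximalRealSubfield L)))) hsg hns hϖF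
  obtain ⟨htru, hdetu⟩ := trace_and_det_of_descent (toPlace v w) hϖ0 hsg
  -- `|s ι t| = |2|` (as in file I §2)
  have hzt : Valued.v (z * ((g : Matrix (Fin 2) (Fin 2) (v.adicCompletion ↥(maximalRealSubfield L))).trace)⁻¹) = Valued.v (HeckeCharacter.uniformizer ↥(maximalRealSubfield L) v : v.adicCompletion ↥(maximalRealSubfield L)) ^ n := by
    rw [← map_pow] at hzn ⊢; exact (v_eq_iff_valuation_eq _ _).2 hzn
  have hϖF1 : Valued.v (HeckeCharacter.uniformizer ↥(maximalRealSubfield L) v : v.adicCompletion ↥(maximalRealSubfield L)) < 1 := by rw [hϖF, ← WithZero.exp_zero, WithZero.exp_lt_exp]; norm_num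
  have hzt1 : Valued.v (ε₀ * (z * ((g : Matrix (Fin 2) (Fin 2) (v.adicCompletion ↥(maximalRealSubfield L))).trace)⁻¹) ^ 2) < 1 := by
    rw [Valuation.map_mul, Valuation.map_pow, hzt, ← pow_mul]
    calc Valued.v ε₀ * Valued.v (HeckeCharacter.uniformizer ↥(maximalRealSubfield L) v : v.adicCompletion ↥(maximalRealSubfield L)) ^ (n * 2) ≤ 1 * Valued.v (HeckeCharacter.uniformizer ↥(maximalRealSubfield L) v : v.adicCompletion ↥(maximalRealSubfield L)) ^ (n * 2) := mul_le_mul' ((v_le_one_iff_mem_integer ε₀).2 hε₀) le_rfl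
      _ < 1 := by rw [one_mul]; exact pow_lt_one₀ zero_le hϖF1 (by omega)
  have hunit : Valued.v (1 - ε₀ * (z * ((g : Matrix (Fin 2) (Fin 2) (v.adicCompletion ↥(maximalRealSubfield L))).trace)⁻¹) ^ 2) = 1 := by
    rw [sub_eq_add_neg]; exact Valuation.map_one_add_of_lt _ (by rw [Valuation.map_neg]; exact hzt1)
  have hst : Valued.v (s * toPlace v w (g : Matrix (Fin 2) (Fin 2) (v.adicCompletion ↥(maximalRealSubfield L))).trace) = Valued.v (2 : (w.1.adicCompletion L)) := by
    apply eq_of_sq_eq_sq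
    have hdu : Valued.v ((((localNonsplitEquiv (IsCMField.complexConj L) (Matrix.of fun i j : Fin 2 => if i.val + j.val + 1 = 2 then (1 : L) else 0) (IsCMField.complexConj_ne_one L) w hw) γ₂ : ↥(unitaryGroupOfForm (galAdicCompletionMap (L := L) (IsCMField.complexConj L) hw) (placeForm (Matrix.of fun i j : Fin 2 => if i.val + j.val + 1 = 2 then (1 : L) else 0) w.1))) : GL (Fin 2) (w.1.adicCompletion L)) : Matrix (Fin 2) (Fin 2) (w.1.adicCompletion L)).det = 1 := v_det_coe_eq_one_of_mem_placeForm L w hw ((localNonsplitEquiv (IsCMField.complexConj L) (Matrix.of fun i j : Fin 2 => if i.val + j.val + 1 = 2 then (1 : L) else 0) (IsCMField.complexConj_ne_one L) w hw) γ₂)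
    have htt : (g : Matrix (Fin 2) (Fin 2) (v.adicCompletion ↥(maximalRealSubfield L))).trace * ((g : Matrix (Fin 2) (Fin 2) (v.adicCompletion ↥(maximalRealSubfield L))).trace)⁻¹ = 1 := mul_inv_cancel₀ ht
    have e4d : (4 : (v.adicCompletion ↥(maximalRealSubfield L))) * (g : Matrix (Fin 2) (Fin 2) (v.adicCompletion ↥(maximalRealSubfield L))).det = (g : Matrix (Fin 2) (Fin 2) (v.adicCompletion ↥(maximalRealSubfield L))).trace ^ 2 * (1 - ε₀ * (z * ((g : Matrix (Fin 2) (Fin 2) (v.adicCompletion ↥(maximalRealSubfield L))).trace)⁻¹) ^ 2) := by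
      linear_combination (-1 : (v.adicCompletion ↥(maximalRealSubfield L))) * hD + ε₀ * z ^ 2 * ((g : Matrix (Fin 2) (Fin 2) (v.adicCompletion ↥(maximalRealSubfield L))).trace * ((g : Matrix (Fin 2) (Fin 2) (v.adicCompletion ↥(maximalRealSubfield L))).trace)⁻¹ + 1) * htt
    have h1 : toPlace v w (1 - ε₀ * (z * ((g : Matrix (Fin 2) (Fin 2) (v.adicCompletion ↥(maximalRealSubfield L))).trace)⁻¹) ^ 2) ≠ 0 := by
      rw [_root_.map_ne_zero]; intro h0; rw [h0, map_zero] at hunit; exact zero_ne_one hunit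
    have h4 : toPlace v w (4 * (g : Matrix (Fin 2) (Fin 2) (v.adicCompletion ↥(maximalRealSubfield L))).det) = toPlace v w ((g : Matrix (Fin 2) (Fin 2) (v.adicCompletion ↥(maximalRealSubfield L))).trace ^ 2 * (1 - ε₀ * (z * ((g : Matrix (Fin 2) (Fin 2) (v.adicCompletion ↥(maximalRealSubfield L))).trace)⁻¹) ^ 2)) := by
      rw [e4d]
    rw [map_mul, map_mul, map_pow, map_ofNat] at h4
    have hW : (toPlace v w (g : Matrix (Fin 2) (Fin 2) (v.adicCompletion ↥(maximalRealSubfield L))).trace) ^ 2 = 4 * toPlace v w (g : Matrix (Fin 2) (Fin 2) (v.adicCompletion ↥(maximalRealSubfield L))).det * (toPlace v w (1 - ε₀ * (z * ((g : Matrix (Fin 2) (Fin 2) (v.adicCompletion ↥(maximalRealSubfield L))).trace)⁻¹) ^ 2))⁻¹ := by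
      rw [eq_mul_inv_iff_mul_eq₀ h1]; exact h4.symm
    have e : (s * toPlace v w (g : Matrix (Fin 2) (Fin 2) (v.adicCompletion ↥(maximalRealSubfield L))).trace) ^ 2 = (2 : (w.1.adicCompletion L)) ^ 2 * (s ^ 2 * toPlace v w (g : Matrix (Fin 2) (Fin 2) (v.adicCompletion ↥(maximalRealSubfield L))).det) * (toPlace v w (1 - ε₀ * (z * ((g : Matrix (Fin 2) (Fin 2) (v.adicCompletion ↥(maximalRealSubfield L))).trace)⁻¹) ^ 2))⁻¹ := by
      calc (s * toPlace v w (g : Matrix (Fin 2) (Fin 2) (v.adicCompletion ↥(maximalRealSubfield L))).trace) ^ 2 = s ^ 2 * (toPlace v w (g : Matrix (Fin 2) (Fin 2) (v.adicCompletion ↥(maximalRealSubfield L))).trace) ^ 2 := by ring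
        _ = s ^ 2 * (4 * toPlace v w (g : Matrix (Fin 2) (Fin 2) (v.adicCompletion ↥(maximalRealSubfield L))).det * (toPlace v w (1 - ε₀ * (z * ((g : Matrix (Fin 2) (Fin 2) (v.adicCompletion ↥(maximalRealSubfield L))).trace)⁻¹) ^ 2))⁻¹) := by rw [hW]
        _ = (2 : (w.1.adicCompletion L)) ^ 2 * (s ^ 2 * toPlace v w (g : Matrix (Fin 2) (Fin 2) (v.adicCompletion ↥(maximalRealSubfield L))).det) * (toPlace v w (1 - ε₀ * (z * ((g : Matrix (Fin 2) (Fin 2) (v.adicCompletion ↥(maximalRealSubfield L))).trace)⁻¹) ^ 2))⁻¹ := by ring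
    rw [← Valuation.map_pow, ← Valuation.map_pow, e, Valuation.map_mul, Valuation.map_mul, map_inv₀, valued_toPlace_eq_sq_of_ramified L v w hw he (1 - _), hunit, one_pow,
      inv_one, mul_one, ← hdetu, hdu, mul_one]
  -- suppose a coset lies in the top set
  refine Set.eq_empty_iff_forall_notMem.2 fun x => ?_
  rintro ⟨h, -, hP⟩
  -- the monodromy `M`, its unitarity, trace and determinant
  set M : Matrix (Fin 2) (Fin 2) (w.1.adicCompletion L) := ((((localNonsplitEquiv (IsCMField.complexConj L) (Matrix.of fun i j : Fin 2 => if i.val + j.val + 1 = 2 then (1 : L) else 0) (IsCMField.complexConj_ne_one L) w hw) (h⁻¹ * γ₂ * h) : ↥(unitaryGroupOfForm (galAdicCompletionMap (L := L) (IsCMField.complexConj L) hw) (placeForm (Matrix.of fun i j : Fin 2 => if i.val + j.val + 1 = 2 then (1 : L) else 0) w.1))) : GL (Fin 2) (w.1.adicCompletion L)) : Matrix (Fin 2) (Fin 2) (w.1.adicCompletion L)) with hMdef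
  have hMU := coe_mem_unitaryGroupOfForm_antidiag_two_of_mem_placeForm L w hw ((localNonsplitEquiv (IsCMField.complexConj L) (Matrix.of fun i j : Fin 2 => if i.val + j.val + 1 = 2 then (1 : L) else 0) (IsCMField.complexConj_ne_one L) w hw) (h⁻¹ * γ₂ * h))
  rw [mem_unitaryGroupOfForm_iff] at hMU
  have hconj : M = ((((((localNonsplitEquiv (IsCMField.complexConj L) (Matrix.of fun i j : Fin 2 => if i.val + j.val + 1 = 2 then (1 : L) else 0) (IsCMField.complexConj_ne_one L) w hw) h : ↥(unitaryGroupOfForm (galAdicCompletionMap (L := L) (IsCMField.complexConj L) hw) (placeForm (Matrix.of fun i j : Fin 2 => if i.val + j.val + 1 = 2 then (1 : L) else 0) w.1))) : GL (Fin 2) (w.1.adicCompletion L)))⁻¹ : GL (Fin 2) (w.1.adicCompletion L)) : Matrix (Fin 2) (Fin 2) (w.1.adicCompletion L)) * ((((localNonsplitEquiv (IsCMField.complexConj L) (Matrix.of fun i j : Fin 2 => if i.val + j.val + 1 = 2 then (1 : L) else 0) (IsCMField.complexConj_ne_one L) w hw) γ₂ : ↥(unitaryGroupOfForm (galAdicCompletionMap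 (L := L) (IsCMField.complexConj L) hw) (placeForm (Matrix.of fun i j : Fin 2 => if i.val + j.val + 1 = 2 then (1 : L) else 0) w.1))) : GL (Fin 2) (w.1.adicCompletion L)) : Matrix (Fin 2) (Fin 2) (w.1.adicCompletion L)) * ((((localNonsplitEquiv (IsCMField.complexConj L) (Matrix.of fun i j : Fin 2 => if i.val + j.val + 1 = 2 then (1 : L) else 0) (IsCMField.complexConj_ne_one L) w hw) h : ↥(unitaryGroupOfForm (galAdicCompletionMap (L := L) (IsCMField.complexConj L) hw) (placeForm (Matrix.of fun i j : Fin 2 => if i.val + j.val + 1 = 2 then (1 : L) else 0) w.1))) : GL (Fin 2) (w.1.adicCompletion L)) : Matrix (Fin 2) (Fin 2) (w.1.adicCompletion L)) := by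
    have h1 := map_mul (localNonsplitEquiv (IsCMField.complexConj L) (Matrix.of fun i j : Fin 2 => if i.val + j.val + 1 = 2 then (1 : L) else 0) (IsCMField.complexConj_ne_one L) w hw) (h⁻¹ * γ₂) h
    have h2 := map_mul (localNonsplitEquiv (IsCMField.complexConj L) (Matrix.of fun i j : Fin 2 => if i.val + j.val + 1 = 2 then (1 : L) else 0) (IsCMField.complexConj_ne_one L) w hw) h⁻¹ γ₂
    have h3 := map_inv (localNonsplitEquiv (IsCMField.complexConj L) (Matrix.of fun i j : Fin 2 => if i.val + j.val + 1 = 2 then (1 : L) else 0) (IsCMField.complexConj_ne_one L) w hw) h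
    rw [h2, h3] at h1
    have h4 := congrArg (fun z : ↥(unitaryGroupOfForm (galAdicCompletionMap (L := L) (IsCMField.complexConj L) hw) (placeForm (Matrix.of fun i j : Fin 2 => if i.val + j.val + 1 = 2 then (1 : L) else 0) w.1)) => ((z : GL (Fin 2) (w.1.adicCompletion L)) : Matrix (Fin 2) (Fin 2) (w.1.adicCompletion L))) h1
    simp only [Subgroup.coe_mul, Subgroup.coe_inv, Units.val_mul] at h4
    exact h4
  have htrM : M.trace = ((((localNonsplitEquiv (IsCMField.complexConj L) (Matrix.of fun i j : Fin 2 => if i.val + j.val + 1 = 2 then (1 : L) else 0) (IsCMField.complexConj_ne_one L) w hw) γ₂ : ↥(unitaryGroupOfForm (galAdicCompletionMap (L := L) (IsCMField.complexConj L) hw) (placeForm (Matrix.of fun i j : Fin 2 => if i.val + j.val + 1 = 2 then (1 : L) else 0) w.1))) : GL (Fin 2) (w.1.adicCompletion L)) : Matrix (Fin 2) (Fin 2) (w.1.adicCompletion L)).trace := by rw [hconj, Matrix.trace_units_conj']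
  have hdetM : M.det = ((((localNonsplitEquiv (IsCMField.complexConj L) (Matrix.of fun i j : Fin 2 => if i.val + j.val + 1 = 2 then (1 : L) else 0) (IsCMField.complexConj_ne_one L) w hw) γ₂ : ↥(unitaryGroupOfForm (galAdicCompletionMap (L := L) (IsCMField.complexConj L) hw) (placeForm (Matrix.of fun i j : Fin 2 => if i.val + j.val + 1 = 2 then (1 : L) else 0) w.1))) : GL (Fin 2) (w.1.adicCompletion L)) : Matrix (Fin 2) (Fin 2) (w.1.adicCompletion L)).det := by rw [hconj, Matrix.det_units_conj']
  -- `c`, `π = ϖ^(2n)`, `Q = π⁻¹ (M − c·1)`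
  set c : (w.1.adicCompletion L) := ((((localNonsplitEquiv (IsCMField.complexConj L) (Matrix.of fun i j : Fin 2 => if i.val + j.val + 1 = 2 then (1 : L) else 0) (IsCMField.complexConj_ne_one L) w hw) γ₂ : ↥(unitaryGroupOfForm (galAdicCompletionMap (L := L) (IsCMField.complexConj L) hw) (placeForm (Matrix.of fun i j : Fin 2 => if i.val + j.val + 1 = 2 then (1 : L) else 0) w.1))) : GL (Fin 2) (w.1.adicCompletion L)) : Matrix (Fin 2) (Fin 2) (w.1.adicCompletion L)).trace / 2 with hcdef
  set π : (w.1.adicCompletion L) := (ϖ : (w.1.adicCompletion L)) ^ (2 * n) with hπdef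
  have hπ0 : π ≠ 0 := pow_ne_zero _ hϖ0
  have hπ1 : Valued.v π < 1 := by
    rw [hπdef, Valuation.map_pow, hϖ, ← WithZero.exp_nsmul, ← WithZero.exp_zero, WithZero.exp_lt_exp]; simp only [nsmul_eq_mul]; omega
  have hσπ : galAdicCompletionMap (L := L) (IsCMField.complexConj L) hw π = π := by
    rw [hπdef, map_pow, hσϖ, pow_mul, pow_mul, neg_sq]
  set Q : Matrix (Fin 2) (Fin 2) (w.1.adicCompletion L) := π⁻¹ • (M - c • (1 : Matrix (Fin 2) (Fin 2) (w.1.adicCompletion L))) with hQdef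
  have hQint : ∀ a b : Fin 2, Valued.v (Q a b) ≤ 1 := by
    intro a b
    rw [hQdef, Matrix.smul_apply, smul_eq_mul, Valuation.map_mul, map_inv₀]
    have hPab := hP a b
    calc (Valued.v π)⁻¹ * Valued.v ((M - c • (1 : Matrix (Fin 2) (Fin 2) (w.1.adicCompletion L))) a b) ≤ (Valued.v π)⁻¹ * Valued.v π := mul_le_mul_right hPab _
      _ = 1 := inv_mul_cancel₀ ((Valuation.ne_zero_iff _).2 hπ0)
  have hMcQ : M = c • (1 : Matrix (Fin 2) (Fin 2) (w.1.adicCompletion L)) + π • Q := by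
    rw [hQdef, smul_smul, mul_inv_cancel₀ hπ0, one_smul, add_sub_cancel]
  -- `|c| = 1`, `c = ½ s ι t`
  have hc' : c = s * toPlace v w (g : Matrix (Fin 2) (Fin 2) (v.adicCompletion ↥(maximalRealSubfield L))).trace / 2 := by rw [hcdef, htru]
  have hcv : Valued.v c = 1 := by
    rw [hc', map_div₀, hst, h2w, div_one]
  -- unitarity ⇒ `Q` residually diagonal
  obtain ⟨hQ10, hQ01⟩ := valued_two_mul_lt_one_of_unitary_entry L v w hw he hMcQ hQint hcv.le hπ0 hπ1 hσπ hMU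
  have hc0 : c ≠ 0 := fun h0 => by rw [h0, map_zero] at hcv; exact zero_ne_one hcv
  have h2c : Valued.v (2 * c) = 1 := by rw [Valuation.map_mul, h2w, hcv, one_mul]
  have hQ10' : Valued.v (Q 1 0) < 1 := by
    have e : (2 * c)⁻¹ * (2 * c * Q 1 0) = Q 1 0 := by rw [← mul_assoc, inv_mul_cancel₀ (mul_ne_zero h2w0 hc0), one_mul]
    rw [← e, Valuation.map_mul, map_inv₀, h2c, inv_one, one_mul]; exact hQ10
  have hQ01' : Valued.v (Q 0 1) < 1 := by
    have e : (2 * c)⁻¹ * (2 * c * Q 0 1) = Q 0 1 := by rw [← mul_assoc, inv_mul_cancel₀ (mul_ne_zero h2w0 hc0), one_mul]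
    rw [← e, Valuation.map_mul, map_inv₀, h2c, inv_one, one_mul]; exact hQ01
  -- Cayley–Hamilton: `Q² = π⁻²(c² − det M)·1`, and `c² − det M = (½ s ι z)² ι ε₀`
  have hPP := sq_sub_half_trace_smul_one h2w0 M
  rw [htrM, ← hcdef] at hPP
  have hQQ : Q * Q = (π⁻¹ ^ 2 * (c ^ 2 - M.det)) • (1 : Matrix (Fin 2) (Fin 2) (w.1.adicCompletion L)) := by
    rw [hQdef, Matrix.smul_mul, Matrix.mul_smul, hPP, smul_smul, smul_smul]; ring_nf
  have hcd : c ^ 2 - M.det = (s * toPlace v w z / 2) ^ 2 * toPlace v w ε₀ := by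
    rw [hdetM, hdetu, hc']
    have hD' : toPlace v w ((g : Matrix (Fin 2) (Fin 2) (v.adicCompletion ↥(maximalRealSubfield L))).trace ^ 2 - 4 * (g : Matrix (Fin 2) (Fin 2) (v.adicCompletion ↥(maximalRealSubfield L))).det) = toPlace v w (ε₀ * z ^ 2) := by rw [hD]
    rw [map_sub, map_mul, map_pow, map_ofNat, map_mul, map_pow] at hD'
    linear_combination (s ^ 2 / 4) * hD'
  set w₀ : (w.1.adicCompletion L) := π⁻¹ * (s * toPlace v w z / 2) with hw₀
  have hsz : Valued.v (s * toPlace v w z) = Valued.v π := by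
    have hιt : toPlace v w (g : Matrix (Fin 2) (Fin 2) (v.adicCompletion ↥(maximalRealSubfield L))).trace ≠ 0 := by rw [_root_.map_ne_zero]; exact ht
    have e : s * toPlace v w z = (s * toPlace v w (g : Matrix (Fin 2) (Fin 2) (v.adicCompletion ↥(maximalRealSubfield L))).trace) *
        toPlace v w (z * ((g : Matrix (Fin 2) (Fin 2) (v.adicCompletion ↥(maximalRealSubfield L))).trace)⁻¹) := by
      rw [map_mul, map_inv₀]; field_simp
    rw [e, Valuation.map_mul, hst, h2w, one_mul, valued_toPlace_eq_sq_of_ramified L v w hw he, hzt, hϖF, hπdef, Valuation.map_pow, hϖ, ← pow_mul, mul_comm n 2]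
  have hw₀v : Valued.v w₀ = 1 := by
    rw [hw₀, Valuation.map_mul, map_inv₀, map_div₀, hsz, h2w, div_one, inv_mul_cancel₀ ((Valuation.ne_zero_iff _).2 hπ0)]
  have hQQ' : Q * Q = (w₀ ^ 2 * toPlace v w ε₀) • (1 : Matrix (Fin 2) (Fin 2) (w.1.adicCompletion L)) := by
    rw [hQQ, hcd, hw₀]; ring_nf
  -- entry (0,0): `Q₀₀² + Q₀₁Q₁₀ = w₀² ιε₀`
  have h00 : Q 0 0 * Q 0 0 + Q 0 1 * Q 1 0 = w₀ ^ 2 * toPlace v w ε₀ := by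
    have h := congrArg (fun X : Matrix (Fin 2) (Fin 2) (w.1.adicCompletion L) => X 0 0) hQQ'
    simpa [Matrix.mul_apply, Fin.sum_univ_two] using h
  -- `b := Q₀₀ ∕ w₀` would be a residual square root of `ι ε₀`
  have hw₀0 : w₀ ≠ 0 := fun h0 => by rw [h0, map_zero] at hw₀v; exact zero_ne_one hw₀v
  have hb : Valued.v (Q 0 0 / w₀) ≤ 1 := by rw [map_div₀, hw₀v, div_one]; exact hQint 0 0
  have hcontra := valued_sq_sub_toPlace_eq_one_of_nonsquare L v w hw he hϖ hns (Q 0 0 / w₀) hb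
  have e : (Q 0 0 / w₀) ^ 2 - toPlace v w ε₀ = -(Q 0 1 * Q 1 0) / w₀ ^ 2 := by
    field_simp
    linear_combination h00
  rw [e, map_div₀, Valuation.map_neg, Valuation.map_pow, hw₀v, one_pow, div_one, Valuation.map_mul] at hcontra
  exact absurd hcontra (ne_of_lt (mul_lt_one_of_lt_of_le hQ01' (hQint 1 0)))

include hw in
/-- **THE TOP COUNT IN FILE II's CURRENCY**: the `K⁰`-column at `j = n` has `Nat.card = (q+1)·Σ_(k ∈ range (n − n)) q^k` (`= 0`), so that the even-depth formula of ★
`natCard_depthFixed_selfDual_and_modular_of_even_depth_ramified` holds for every `j ≤ n` in the `K⁰` column. [cite: LabesseLanglands1979, §2 Lemma 2.1 p. 8] -/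
theorem natCard_depthFixed_selfDual_top_of_even_depth_ramified (he : v.asIdeal.ramificationIdx' w.1.asIdeal ≠ 1) (h2 : IsUnit (2 : 𝒪[(w.1.adicCompletion L)]))
    (ϖ : (w.1.adicCompletion L)ˣ) (hϖ : Valued.v (ϖ : (w.1.adicCompletion L)) = WithZero.exp (-1 : ℤ))
    (hσϖ : galAdicCompletionMap (L := L) (IsCMField.complexConj L) hw (ϖ : (w.1.adicCompletion L)) = -(ϖ : (w.1.adicCompletion L)))
    (γ₂ : ((cmDatum L 2 (Matrix.of fun i j : Fin 2 => if i.val + j.val + 1 = 2 then (1 : L) else 0)).Local v))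
    (hirr : ¬ ∃ x : (w.1.adicCompletion L), (((((localNonsplitEquiv (IsCMField.complexConj L) (Matrix.of fun i j : Fin 2 => if i.val + j.val + 1 = 2 then (1 : L) else 0) (IsCMField.complexConj_ne_one L) w hw) γ₂ : ↥(unitaryGroupOfForm (galAdicCompletionMap (L := L) (IsCMField.complexConj L) hw) (placeForm (Matrix.of fun i j : Fin 2 => if i.val + j.val + 1 = 2 then (1 : L) else 0) w.1))) : GL (Fin 2) (w.1.adicCompletion L)) : Matrix (Fin 2) (Fin 2) (w.1.adicCompletion L)).charpoly).IsRoot x)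
    {n : ℕ} (hn1 : 1 ≤ n) (hN : Valued.v (((((localNonsplitEquiv (IsCMField.complexConj L) (Matrix.of fun i j : Fin 2 => if i.val + j.val + 1 = 2 then (1 : L) else 0) (IsCMField.complexConj_ne_one L) w hw) γ₂ : ↥(unitaryGroupOfForm (galAdicCompletionMap (L := L) (IsCMField.complexConj L) hw) (placeForm (Matrix.of fun i j : Fin 2 => if i.val + j.val + 1 = 2 then (1 : L) else 0) w.1))) : GL (Fin 2) (w.1.adicCompletion L)) : Matrix (Fin 2) (Fin 2) (w.1.adicCompletion L)).trace ^ 2 - 4 * ((((localNonsplitEquiv (IsCMField.complexConj L) (Matrix.of fun i j : Fin 2 => if i.val + j.val + 1 = 2 then (1 : L) else 0) (IsCMField.complexConj_ne_one L) w hw) γ₂ : ↥(unitaryGroupOfForm (galAdicCompletionMap (L := L) (IsCMField.complexConj L) hw) (placeForm (Matrix.of fun i j : Fin 2 => if i.val + j.val + 1 = 2 then (1 : L) else 0) w.1))) : GL (Fin 2) (w.1.adicCompletion L)) : Matrix (Fin 2) (Fin 2) (w.1.adicCompletion L)).det) = WithZero.exp (-((2 * (2 * n) : ℕ) : ℤ)))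 :
    Nat.card {x : ((cmDatum L 2 (Matrix.of fun i j : Fin 2 => if i.val + j.val + 1 = 2 then (1 : L) else 0)).Local v) ⧸ (cmLocalIntegralLevel L 2 (Matrix.of fun i j : Fin 2 => if i.val + j.val + 1 = 2 then (1 : L) else 0) v) | ∃ h : ((cmDatum L 2 (Matrix.of fun i j : Fin 2 => if i.val + j.val + 1 = 2 then (1 : L) else 0)).Local v), x = (h : ((cmDatum L 2 (Matrix.of fun i j : Fin 2 => if i.val + j.val + 1 = 2 then (1 : L) else 0)).Local v) ⧸ (cmLocalIntegralLevel L 2 (Matrix.of fun i j : Fin 2 => if i.val + j.val + 1 = 2 then (1 : L) else 0) v)) ∧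
      ∀ a b : Fin 2, Valued.v ((((((localNonsplitEquiv (IsCMField.complexConj L) (Matrix.of fun i j : Fin 2 => if i.val + j.val + 1 = 2 then (1 : L) else 0) (IsCMField.complexConj_ne_one L) w hw) (h⁻¹ * γ₂ * h) : ↥(unitaryGroupOfForm (galAdicCompletionMap (L := L) (IsCMField.complexConj L) hw) (placeForm (Matrix.of fun i j : Fin 2 => if i.val + j.val + 1 = 2 then (1 : L) else 0) w.1))) : GL (Fin 2) (w.1.adicCompletion L)) : Matrix (Fin 2) (Fin 2) (w.1.adicCompletion L)) - (((((localNonsplitEquiv (IsCMField.complexConj L) (Matrix.of fun i j : Fin 2 => if i.val + j.val + 1 = 2 then (1 : L) else 0) (IsCMField.complexConj_ne_one L) w hw) γ₂ : ↥(unitaryGroupOfForm (galAdicCompletionMap (L := L) (IsCMField.complexConj L) hw) (placeForm (Matrix.of fun i j : Fin 2 => if i.val + j.val + 1 = 2 then (1 : L) else 0) w.1))) : GL (Fin 2) (w.1.adicCompletion L)) : Matrix (Fin 2) (Fin 2) (w.1.adicCompletion L)).trace / 2) • (1 : Matrix (Fin 2) (Fin 2) (w.1.adicCompletion L))) a b)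 ≤ Valued.v ((ϖ : (w.1.adicCompletion L)) ^ (2 * n))} =
      (Nat.card (𝓞 ↥(maximalRealSubfield L) ⧸ v.asIdeal) + 1) * ∑ k ∈ Finset.range (n - n), Nat.card (𝓞 ↥(maximalRealSubfield L) ⧸ v.asIdeal) ^ k := by
  rw [depthFixed_selfDual_top_eq_empty_of_even_depth_ramified L v w hw he h2 ϖ hϖ hσϖ γ₂ hirr hn1 hN, Nat.sub_self, Finset.range_zero, Finset.sum_empty, mul_zero]
  simp

end Top

end Literature.NumberTheory.Automorphic.UnitaryGroup

end
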